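import Summits.CriticalPhenomena.PercolationContinuityZ3.Theorems.Transplant.FKConnectivityAllQEdgeNegCorr
import HarnessLib

/-!
# Connectivity correlation inequalities for `φ_{w,q}`, every `q > 0` — file 6: CONDITIONING ON A CONNECTION RAISES THE MEASURE
# ⟺ AN OPEN EDGE LOWERS THE REST (`q < 1`); the edge ↔ connection duality at the level of arbitrary increasing events

Support file (`--supports stmt-CriticalPhenomena-4575`), FK sub-lane `prim-bschramm-fk-2` (gen 6) of the post-continuity
programme; builds on p205010 (kernel theorem, internal audit signed; external expert review pending).  No named facts, no sorries;
standard axioms.  Continues `…AllQEdgeMono/Toggle/NegCorr.lean`.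

TWO STATEMENTS (finite vertex type `V`, `φ = φ^∅_{w,q}`, `J_e = {e open}`):
* `ConnUpCorrOn V q` (UPC): `φ(x ↔ y)·φ(F) ≤ φ({x ↔ y} ∩ F)` for all `w, x, y` and EVERY increasing event `F` — conditioning on a
  two-point connection stochastically raises the measure (Strassen).  For `q ≥ 1` this is FKG (Grimmett 2006 Thm. (3.8));
  for `q < 1` it contains EC⁺ (`F = J_f`) and pairwise positive correlation of connection events (`F = {u ↔ v}`).
* `EdgeNegDepOn V q` (CD): `φ(J_e ∩ F) ≤ φ(J_e)·φ(F)` for every non-loop pair `e` and every increasing event `F` NOT depending on `e` —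
  an open edge stochastically lowers the rest: the `|A| = 1` case of NEGATIVE ASSOCIATION (Grimmett 2006 §3.9, second notion, p. 63:
  `μ(A ∩ B) ≤ μ(A)μ(B)` for increasing `A, B` defined on disjoint edge sets), conjectured for `q < 1` ("it may be conjectured that
  `φ_{p,q}` satisfies some form of negative association when `q < 1` … no such property has yet been proved", p. 64); it contains
  edge-negative association NC (`F = J_f`).

PROVED HERE (kernel):
* `FK.conn_defect_eq_lift` (any `q ≠ 0`): for `e = s(x,y)` of parameter `c` and ANY event `F` with lower `e`-section `F₀` and upper
  `e`-section `F₁`:  `D_w(x↔y, F) = (1−c)·D_{w[e↦0]}(x↔y, F₀) + c(1−c)·(S_{w[e↦1]}(F₁) − S_{w[e↦1]}(F₀))·S_{w[e↦0]}(x↮y)`,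
  `D_w(A,F) := S_w(A ∩ F)Z_w − S_w(A)S_w(F)` — so for increasing `F` the covariance of `{x↔y}` with `F` is at least `(1−c)` times the
  covariance, one edge down, with the `e`-insensitive increasing event `F₀`.
* **`FK.connUpCorrOn_iff_edgeNegDepOn`** (`0 < q < 1`): UPC ⟺ CD, by the lift and the duality `FK.openPair_defect_eq_neg_conn_defect`
  (`Cov_w(J_e, F) = −c(1−c)(q⁻¹−1)·Cov_{w[e↦0]}(1{x↔y}, F)`, unnormalised) applied at `w[e↦½]`.
* Corollaries: `FK.edgeNegCorrOn_of_edgeNegDepOn` (CD ⇒ NC), `FK.pairConnPosUnder_of_connUpCorrOn` (UPC ⇒ pairwise positive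
  correlation of connection events), `FK.edgeConnMonoOn_of_connUpCorrOn` (UPC ⇒ EC⁺, any `q > 0`, via `FK.inter_openPair_defect_eq`),
  `FK.connUpCorrOn_of_one_le` (FKG), and the conjecture nodes `ConnUpCorrFKPos` (`∀ q > 0`), `EdgeNegDepFKLtOne` (`0 < q < 1`) with
  `connUpCorrFKPos_of_edgeNegDepFKLtOne`, `pairConnPosFKPos_of_connUpCorrFKPos`, `edgeNegCorrFKLtOne_of_edgeNegDepFKLtOne`.
  HIERARCHY for `q < 1` (all conjectural, all census-clean on every connected graph with `≤ 6`–`7` vertices, this seat):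
  NA ⇒ CD ⟺ UPC ⇒ {NC ⟺ EC⁺} ⇒ PC2 ⇒ HUB (ALR 2025 (13)).
[cite: Grimmett2006, §3.9 (pp. 63–64); Thm. (3.8); Thm. (3.1)(a) (p. 37); §1.4 eq. (1.20) (p. 15)]
[cite: AyyerLinussonRavichandran2025, §7 eq. (13)–(17), Conj. 7.1 (pp. 22–23)]
-/

noncomputable section

namespace Summit.CriticalPhenomena.PercolationContinuityZ3.Theorems

namespace FK

open MeasureTheory Set Literature.Probability.LatticeModels Literature.Probability.Percolation
open Literature.Probability.Percolation.DecisionTree (ind ind_of_mem ind_of_not_mem ind_nonneg)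
open Literature.Probability.Percolation.TwoAvoidanceSets (ind_mul_ind)
open scoped Classical symmDiff

variable {V : Type*} [Fintype V]

/-! ### The two statements and their conjecture nodes -/

/-- **UPC — conditioning on a connection raises the measure**: `φ(x ↔ y)·φ(F) ≤ φ({x ↔ y} ∩ F)` for every weight vector, vertices
`x, y` and every increasing event `F` (FKG for `q ≥ 1`; conjectural for `q < 1`). [cite: Grimmett2006, Thm. (3.8); §3.9 (p. 63)] -/
def ConnUpCorrOn (V : Type*) [Fintype V] (q : ℝ) : Prop :=
  ∀ (w : Sym2 V → unitInterval) (x y : V) (F : Set (BondConfig V)), IsUpperSet F →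
    (rcMeasureW w q ∅).real (openConn x y) * (rcMeasureW w q ∅).real F ≤ (rcMeasureW w q ∅).real (openConn x y ∩ F)

/-- UPC on every finite weighted graph (vertex types `Fin n`). [cite: Grimmett2006, Thm. (3.8); §3.9 (p. 63)] -/
def ConnUpCorrFK (q : ℝ) : Prop := ∀ n : ℕ, ConnUpCorrOn (Fin n) q

/-- **CD — an open edge lowers the rest** (single-edge negative dependence = negative association with a singleton block):
`φ(J_e ∩ F) ≤ φ(J_e)·φ(F)` for every non-loop pair `e` and every increasing event `F` not depending on `e`.  Conjectured for `q < 1`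
(Grimmett 2006 §3.9: negative association); false for `q > 1`. [cite: Grimmett2006, §3.9 (pp. 63–64)] -/
def EdgeNegDepOn (V : Type*) [Fintype V] (q : ℝ) : Prop :=
  ∀ (w : Sym2 V → unitInterval) (e : Sym2 V) (F : Set (BondConfig V)), ¬ e.IsDiag → IsUpperSet F →
    (∀ ω : BondConfig V, ω ∆ {e} ∈ F ↔ ω ∈ F) →
    (rcMeasureW w q ∅).real ({ω | e ∈ ω} ∩ F) ≤ (rcMeasureW w q ∅).real {ω | e ∈ ω} * (rcMeasureW w q ∅).real F

/-- CD on every finite weighted graph (vertex types `Fin n`). [cite: Grimmett2006, §3.9 (pp. 63–64)] -/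
def EdgeNegDepFK (q : ℝ) : Prop := ∀ n : ℕ, EdgeNegDepOn (Fin n) q

/-- **UPC for every `q > 0`.**  CONJECTURE-SHAPED STATEMENT, NOT asserted (`q ≥ 1`: FKG; `0 < q < 1`: equivalent to `EdgeNegDepFK q`,
open).  Evidence (fk-2 gen 6, 2026-08-20): 0 violations for random up-sets on every connected graph with `≤ 6` vertices (1.25·10⁶ cells)
and for the structured families `J_f ∩ J_g`, `J_f ∪ J_g`, `{S joined}`, `{k ≤ c}` (0/8·10⁵ cells). [cite: Grimmett2006, §3.9 (pp. 63–64); Thm. (3.8)] -/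
@[conjecture] def ConnUpCorrFKPos : Prop := ∀ q : ℝ, 0 < q → ConnUpCorrFK q

/-- **Single-edge negative dependence of `φ_{p,q}` for every `0 < q < 1`.**  CONJECTURE-SHAPED STATEMENT, NOT asserted — the singleton
case of the negative-association conjecture for the random-cluster measure with `q < 1` (Grimmett 2006 §3.9; Pemantle 2000); open.
[cite: Grimmett2006, §3.9 (pp. 63–64)] -/
@[conjecture] def EdgeNegDepFKLtOne : Prop := ∀ q : ℝ, 0 < q → q < 1 → EdgeNegDepFK q

/-! ### Sections of an event at a pair -/

omit [Fintype V] in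
/-- The event `J_f` does not depend on a different pair `e`. [folklore] -/
theorem symmDiff_singleton_mem_openPair_iff {e f : Sym2 V} (hfe : f ≠ e) (ω : BondConfig V) :
    ω ∆ {e} ∈ ({ω | f ∈ ω} : Set (BondConfig V)) ↔ ω ∈ ({ω | f ∈ ω} : Set (BondConfig V)) := by
  simp only [Set.mem_setOf_eq, Set.mem_symmDiff, Set.mem_singleton_iff, hfe, not_false_eq_true, and_true, false_and, or_false]

omit [Fintype V] in
/-- The lower `e`-section `F₀ = {ω | ω ∖ {e} ∈ F}` does not depend on `e`. [folklore] -/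
theorem symmDiff_singleton_mem_lowerSection_iff (e : Sym2 V) (F : Set (BondConfig V)) (ω : BondConfig V) :
    ω ∆ {e} ∈ ({ω | ω \ {e} ∈ F} : Set (BondConfig V)) ↔ ω ∈ ({ω | ω \ {e} ∈ F} : Set (BondConfig V)) := by
  have h : (ω ∆ {e}) \ {e} = ω \ {e} := by
    ext f
    simp only [Set.mem_sdiff, Set.mem_symmDiff, Set.mem_singleton_iff]
    tauto
  simp only [Set.mem_setOf_eq, h]

/-- Under `w[e↦0]` an event may be replaced by any event agreeing with it off `J_e`. [cite: Grimmett2006, §1.4 eq. (1.20) (p. 15)] -/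
theorem sum_rcWeightW_update_zero_congr (w : Sym2 V → unitInterval) (q : ℝ) (e : Sym2 V) {F F' : Set (BondConfig V)}
    (h : ∀ ω : BondConfig V, e ∉ ω → (ω ∈ F ↔ ω ∈ F')) :
    ∑ ω : BondConfig V, rcWeightW (Function.update w e 0) q ∅ ω * ind F ω =
      ∑ ω : BondConfig V, rcWeightW (Function.update w e 0) q ∅ ω * ind F' ω := by
  refine Finset.sum_congr rfl fun ω _ => ?_
  by_cases he : e ∈ ω
  · rw [rcWeightW_eq_zero_of_zero_mem (Function.update w e 0) q ∅ (by simp) he, zero_mul, zero_mul]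
  · by_cases hF : ω ∈ F
    · rw [ind_of_mem hF, ind_of_mem ((h ω he).1 hF)]
    · rw [ind_of_not_mem hF, ind_of_not_mem (fun h' => hF ((h ω he).2 h'))]

/-- Under `w[e↦1]` an event may be replaced by any event agreeing with it on `J_e`. [cite: Grimmett2006, §1.4 eq. (1.20) (p. 15)] -/
theorem sum_rcWeightW_update_one_congr (w : Sym2 V → unitInterval) (q : ℝ) (e : Sym2 V) {F F' : Set (BondConfig V)}
    (h : ∀ ω : BondConfig V, e ∈ ω → (ω ∈ F ↔ ω ∈ F')) :
    ∑ ω : BondConfig V, rcWeightW (Function.update w e 1) q ∅ ω * ind F ω =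
      ∑ ω : BondConfig V, rcWeightW (Function.update w e 1) q ∅ ω * ind F' ω := by
  refine Finset.sum_congr rfl fun ω _ => ?_
  by_cases he : e ∈ ω
  · by_cases hF : ω ∈ F
    · rw [ind_of_mem hF, ind_of_mem ((h ω he).1 hF)]
    · rw [ind_of_not_mem hF, ind_of_not_mem (fun h' => hF ((h ω he).2 h'))]
  · rw [rcWeightW_eq_zero_of_one_not_mem (Function.update w e 1) q ∅ (by simp) he, zero_mul, zero_mul]

/-- Masses are monotone in the event. [cite: Grimmett2006, §1.4 eq. (1.20) (p. 15)] -/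
theorem sum_rcWeightW_ind_mono (w : Sym2 V → unitInterval) {q : ℝ} (hq : 0 ≤ q) {F F' : Set (BondConfig V)} (h : F ⊆ F') :
    ∑ ω : BondConfig V, rcWeightW w q ∅ ω * ind F ω ≤ ∑ ω : BondConfig V, rcWeightW w q ∅ ω * ind F' ω := by
  refine Finset.sum_le_sum fun ω _ => mul_le_mul_of_nonneg_left ?_ (rcWeightW_nonneg w hq ∅ ω)
  by_cases hF : ω ∈ F
  · rw [ind_of_mem hF, ind_of_mem (h hF)]
  · rw [ind_of_not_mem hF]; exact ind_nonneg F' ω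

/-! ### The lift identity for the covariance of a connection with an arbitrary event -/

/-- **Covariance of an event with one edge** (any event `A`, any `q`): `S_w(A ∩ J_f)·Z_w − S_w(A)·S_w(J_f) = d(1−d)·[S_{w[f↦1]}(A)·Z_{w[f↦0]}
− S_{w[f↦0]}(A)·Z_{w[f↦1]}]`, `d = w f`. [cite: Grimmett2006, Thm. (3.1)(a) (p. 37)] -/
theorem inter_openPair_defect_eq (w : Sym2 V → unitInterval) (q : ℝ) (f : Sym2 V) (A : Set (BondConfig V)) :
    (∑ ω : BondConfig V, rcWeightW w q ∅ ω * ind (A ∩ {ω | f ∈ ω}) ω) * rcPartitionFunctionW w q ∅ -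
        (∑ ω : BondConfig V, rcWeightW w q ∅ ω * ind A ω) * (∑ ω : BondConfig V, rcWeightW w q ∅ ω * ind {ω | f ∈ ω} ω) =
      (w f : ℝ) * (1 - (w f : ℝ)) *
        ((∑ ω : BondConfig V, rcWeightW (Function.update w f 1) q ∅ ω * ind A ω) * rcPartitionFunctionW (Function.update w f 0) q ∅ -
          (∑ ω : BondConfig V, rcWeightW (Function.update w f 0) q ∅ ω * ind A ω) *
            rcPartitionFunctionW (Function.update w f 1) q ∅) := by
  have s1 := sum_rcWeightW_ind_inter_openPair w q f A
  have s2 := sum_rcWeightW_ind_openPair w q f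
  have s3 := sum_rcWeightW_ind_affine w q f A
  have s4 := rcPartitionFunctionW_affine w q f
  rw [Set.inter_comm, s1, s2, s3, s4]
  ring

/-- **Lift identity** (any `q ≠ 0`): for `e = s(x,y)` with parameter `c = w e`, `A = {x ↔ y}`, ANY event `F`, and its sections
`F₀ = {ω | ω ∖ {e} ∈ F}`, `F₁ = {ω | ω ∪ {e} ∈ F}`:
`D_w(A, F) = (1−c)·D_{w[e↦0]}(A, F₀) + c(1−c)·(S_{w[e↦1]}(F₁) − S_{w[e↦1]}(F₀))·S_{w[e↦0]}(Aᶜ)` with `D_u(A,F) = S_u(A∩F)Z_u − S_u(A)S_u(F)`.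
[cite: Grimmett2006, Thm. (3.1)(a) (p. 37); §1.4 eq. (1.20) (p. 15)] -/
theorem conn_defect_eq_lift (w : Sym2 V → unitInterval) {q : ℝ} (hq : q ≠ 0) (x y : V) (F : Set (BondConfig V)) :
    (∑ ω : BondConfig V, rcWeightW w q ∅ ω * ind (openConn x y ∩ F) ω) * rcPartitionFunctionW w q ∅ -
        (∑ ω : BondConfig V, rcWeightW w q ∅ ω * ind (openConn x y) ω) * (∑ ω : BondConfig V, rcWeightW w q ∅ ω * ind F ω) =
      (1 - (w s(x, y) : ℝ)) *
          ((∑ ω : BondConfig V, rcWeightW (Function.update w s(x, y) 0) q ∅ ω *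
                ind (openConn x y ∩ {ω | ω \ {s(x, y)} ∈ F}) ω) * rcPartitionFunctionW (Function.update w s(x, y) 0) q ∅ -
            (∑ ω : BondConfig V, rcWeightW (Function.update w s(x, y) 0) q ∅ ω * ind (openConn x y) ω) *
              (∑ ω : BondConfig V, rcWeightW (Function.update w s(x, y) 0) q ∅ ω * ind {ω | ω \ {s(x, y)} ∈ F} ω)) +
        (w s(x, y) : ℝ) * (1 - (w s(x, y) : ℝ)) *
          ((∑ ω : BondConfig V, rcWeightW (Function.update w s(x, y) 1) q ∅ ω * ind {ω | insert s(x, y) ω ∈ F} ω) -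
            ∑ ω : BondConfig V, rcWeightW (Function.update w s(x, y) 1) q ∅ ω * ind {ω | ω \ {s(x, y)} ∈ F} ω) *
          ∑ ω : BondConfig V, rcWeightW (Function.update w s(x, y) 0) q ∅ ω * ind (openConn x y : Set (BondConfig V))ᶜ ω := by
  -- decompose at `e`
  have s1 := sum_rcWeightW_ind_affine w q s(x, y) (openConn x y ∩ F)
  have s2 := sum_rcWeightW_ind_affine w q s(x, y) (openConn x y)
  have s3 := sum_rcWeightW_ind_affine w q s(x, y) F
  have s4 := rcPartitionFunctionW_affine w q s(x, y)
  -- the corner masses in terms of the sections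
  have a0 : ∑ ω : BondConfig V, rcWeightW (Function.update w s(x, y) 0) q ∅ ω * ind (openConn x y ∩ F) ω =
      ∑ ω : BondConfig V, rcWeightW (Function.update w s(x, y) 0) q ∅ ω * ind (openConn x y ∩ {ω | ω \ {s(x, y)} ∈ F}) ω :=
    sum_rcWeightW_update_zero_congr w q s(x, y) fun ω he => by
      simp only [Set.mem_inter_iff, Set.mem_setOf_eq, Set.sdiff_singleton_eq_self he]
  have b0 : ∑ ω : BondConfig V, rcWeightW (Function.update w s(x, y) 0) q ∅ ω * ind F ω =
      ∑ ω : BondConfig V, rcWeightW (Function.update w s(x, y) 0) q ∅ ω * ind {ω | ω \ {s(x, y)} ∈ F} ω :=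
    sum_rcWeightW_update_zero_congr w q s(x, y) fun ω he => by
      simp only [Set.mem_setOf_eq, Set.sdiff_singleton_eq_self he]
  have a1 : ∑ ω : BondConfig V, rcWeightW (Function.update w s(x, y) 1) q ∅ ω * ind (openConn x y ∩ F) ω =
      ∑ ω : BondConfig V, rcWeightW (Function.update w s(x, y) 1) q ∅ ω * ind {ω | insert s(x, y) ω ∈ F} ω :=
    sum_rcWeightW_update_one_congr w q s(x, y) fun ω he => by
      have hxy : ω ∈ openConn x y := by
        by_cases h : x = y
        · rw [← h]; exact (mem_openConn_iff' x x ω).2 (SimpleGraph.Reachable.refl x)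
        · exact (mem_openConn_iff' x y ω).2
            (SimpleGraph.Adj.reachable (G := openGraph ω) ((SimpleGraph.fromEdgeSet_adj _).2 ⟨he, h⟩))
      simp only [Set.mem_inter_iff, Set.mem_setOf_eq, Set.insert_eq_of_mem he, hxy, true_and]
  have b1 : ∑ ω : BondConfig V, rcWeightW (Function.update w s(x, y) 1) q ∅ ω * ind F ω =
      ∑ ω : BondConfig V, rcWeightW (Function.update w s(x, y) 1) q ∅ ω * ind {ω | insert s(x, y) ω ∈ F} ω :=
    sum_rcWeightW_update_one_congr w q s(x, y) fun ω he => by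
      simp only [Set.mem_setOf_eq, Set.insert_eq_of_mem he]
  have c1 : ∑ ω : BondConfig V, rcWeightW (Function.update w s(x, y) 1) q ∅ ω * ind (openConn x y) ω =
      rcPartitionFunctionW (Function.update w s(x, y) 1) q ∅ := by
    have h := sum_rcWeightW_ind_compl (Function.update w s(x, y) 1) q (openConn x y : Set (BondConfig V))
    rw [sum_rcWeightW_update_one_compl_openConn w q x y] at h
    linarith
  -- toggles at `e` for the `e`-insensitive lower section and for `Z`
  have t1 := sum_rcWeightW_update_one_eq_toggle w hq x y _ (symmDiff_singleton_mem_lowerSection_iff s(x, y) F)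
  have t2 := rcPartitionFunctionW_update_one_eq_toggle w hq x y
  have c2 := sum_rcWeightW_ind_inter_compl (Function.update w s(x, y) 0) q {ω | ω \ {s(x, y)} ∈ F} (openConn x y)
  have c3 := sum_rcWeightW_ind_compl (Function.update w s(x, y) 0) q (openConn x y : Set (BondConfig V))
  rw [Set.inter_comm ({ω | ω \ {s(x, y)} ∈ F} : Set (BondConfig V)) (openConn x y)] at c2
  rw [s1, s2, s3, s4, a0, b0, a1, b1, c1, t1, t2, c2, c3]
  ring

/-- **Lift inequality**: for increasing `F`, `D_w(x↔y, F) ≥ (1−c)·D_{w[e↦0]}(x↔y, F₀)` (`e = s(x,y)`, `F₀` the lower section; any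
`q > 0`). [cite: Grimmett2006, Thm. (3.1)(a) (p. 37)] -/
theorem conn_defect_ge_lift (w : Sym2 V → unitInterval) {q : ℝ} (hq : 0 < q) (x y : V) {F : Set (BondConfig V)} (hF : IsUpperSet F) :
    (1 - (w s(x, y) : ℝ)) *
        ((∑ ω : BondConfig V, rcWeightW (Function.update w s(x, y) 0) q ∅ ω *
              ind (openConn x y ∩ {ω | ω \ {s(x, y)} ∈ F}) ω) * rcPartitionFunctionW (Function.update w s(x, y) 0) q ∅ -
          (∑ ω : BondConfig V, rcWeightW (Function.update w s(x, y) 0) q ∅ ω * ind (openConn x y) ω) *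
            (∑ ω : BondConfig V, rcWeightW (Function.update w s(x, y) 0) q ∅ ω * ind {ω | ω \ {s(x, y)} ∈ F} ω)) ≤
      (∑ ω : BondConfig V, rcWeightW w q ∅ ω * ind (openConn x y ∩ F) ω) * rcPartitionFunctionW w q ∅ -
        (∑ ω : BondConfig V, rcWeightW w q ∅ ω * ind (openConn x y) ω) * (∑ ω : BondConfig V, rcWeightW w q ∅ ω * ind F ω) := by
  rw [conn_defect_eq_lift w hq.ne' x y F]
  have hsub : ({ω | ω \ {s(x, y)} ∈ F} : Set (BondConfig V)) ⊆ {ω | insert s(x, y) ω ∈ F} := fun ω hω =>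
    hF (Set.sdiff_subset.trans (Set.subset_insert _ _)) hω
  have hmono := sum_rcWeightW_ind_mono (Function.update w s(x, y) 1) hq.le hsub
  have hc0 : 0 ≤ ((w s(x, y) : unitInterval) : ℝ) := (w s(x, y)).2.1
  have hc1 : ((w s(x, y) : unitInterval) : ℝ) ≤ 1 := (w s(x, y)).2.2
  have hN : 0 ≤ ∑ ω : BondConfig V, rcWeightW (Function.update w s(x, y) 0) q ∅ ω * ind (openConn x y : Set (BondConfig V))ᶜ ω :=
    Finset.sum_nonneg fun ω _ => mul_nonneg (rcWeightW_nonneg _ hq.le ∅ ω) (ind_nonneg _ ω)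
  have h1c : 0 ≤ 1 - ((w s(x, y) : unitInterval) : ℝ) := by linarith
  nlinarith [mul_nonneg (mul_nonneg (mul_nonneg hc0 h1c) (sub_nonneg.2 hmono)) hN]

/-! ### UPC ⟺ CD (`0 < q < 1`) -/

/-- **An open edge lowers the rest ⇒ conditioning on a connection raises the measure** (`0 < q < 1`).
[cite: Grimmett2006, §3.9 (pp. 63–64); Thm. (3.8)] -/
theorem connUpCorrOn_of_edgeNegDepOn {q : ℝ} (hq0 : 0 < q) (hq1 : q < 1) (hCD : EdgeNegDepOn V q) : ConnUpCorrOn V q := by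
  intro w x y F hF
  -- trivial case `x = y`
  by_cases hxy : x = y
  · rw [← hxy]
    have huniv : (openConn x x : Set (BondConfig V)) = Set.univ :=
      Set.eq_univ_of_forall fun ω => (mem_openConn_iff' x x ω).2 (SimpleGraph.Reachable.refl x)
    haveI := isProbabilityMeasure_rcMeasureW w hq0 (∅ : Set V)
    rw [huniv, probReal_univ, one_mul, Set.univ_inter]
  -- mass form of the goal: `S(A)S(F) ≤ Z·S(A ∩ F)`
  have hZ := rcPartitionFunctionW_pos w hq0 (∅ : Set V)
  rw [rcMeasureW_real_eq_sum_div w hq0 ∅, rcMeasureW_real_eq_sum_div w hq0 ∅, rcMeasureW_real_eq_sum_div w hq0 ∅,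
    div_mul_div_comm, div_le_div_iff₀ (mul_pos hZ hZ) hZ]
  suffices hD : 0 ≤ (∑ ω : BondConfig V, rcWeightW w q ∅ ω * ind (openConn x y ∩ F) ω) * rcPartitionFunctionW w q ∅ -
      (∑ ω : BondConfig V, rcWeightW w q ∅ ω * ind (openConn x y) ω) * (∑ ω : BondConfig V, rcWeightW w q ∅ ω * ind F ω) by
    nlinarith [hD, hZ]
  refine le_trans ?_ (conn_defect_ge_lift w hq0 x y hF)
  -- the defect one edge down is `≥ 0`: duality at `u = w[e↦½]` with CD for the lower section `F₀`
  have hc1 : ((w s(x, y) : unitInterval) : ℝ) ≤ 1 := (w s(x, y)).2.2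
  refine mul_nonneg (by linarith) ?_
  set half : unitInterval := ⟨2⁻¹, by norm_num, by norm_num⟩ with hhalf
  have hdiag : ¬ (s(x, y) : Sym2 V).IsDiag := by rw [Sym2.mk_isDiag_iff]; exact hxy
  have hF₀up : IsUpperSet ({ω | ω \ {s(x, y)} ∈ F} : Set (BondConfig V)) := fun ω ω' hle hω =>
    hF (Set.sdiff_subset_sdiff_left hle) hω
  have hN := hCD (Function.update w s(x, y) half) s(x, y) {ω | ω \ {s(x, y)} ∈ F} hdiag hF₀up
    (symmDiff_singleton_mem_lowerSection_iff s(x, y) F)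
  have hZu := rcPartitionFunctionW_pos (Function.update w s(x, y) half) hq0 (∅ : Set V)
  rw [rcMeasureW_real_eq_sum_div _ hq0 ∅, rcMeasureW_real_eq_sum_div _ hq0 ∅, rcMeasureW_real_eq_sum_div _ hq0 ∅,
    div_mul_div_comm, div_le_div_iff₀ hZu (mul_pos hZu hZu)] at hN
  have hdef : (∑ ω : BondConfig V, rcWeightW (Function.update w s(x, y) half) q ∅ ω *
        ind ({ω | s(x, y) ∈ ω} ∩ {ω | ω \ {s(x, y)} ∈ F}) ω) * rcPartitionFunctionW (Function.update w s(x, y) half) q ∅ -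
      (∑ ω : BondConfig V, rcWeightW (Function.update w s(x, y) half) q ∅ ω * ind {ω | s(x, y) ∈ ω} ω) *
        (∑ ω : BondConfig V, rcWeightW (Function.update w s(x, y) half) q ∅ ω * ind {ω | ω \ {s(x, y)} ∈ F} ω) ≤ 0 := by
    have h2 := mul_le_mul_of_nonneg_right (show _ ≤ _ from hN) hZu.le
    nlinarith [hN, hZu]
  rw [openPair_defect_eq_neg_conn_defect (Function.update w s(x, y) half) hq0.ne' x y _
    (symmDiff_singleton_mem_lowerSection_iff s(x, y) F), Function.update_self, Function.update_idem] at hdef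
  have hpos : 0 < ((half : unitInterval) : ℝ) * (1 - ((half : unitInterval) : ℝ)) * (q⁻¹ - 1) := by
    have h2 : ((half : unitInterval) : ℝ) = 2⁻¹ := rfl
    rw [h2]
    have hr : 0 < q⁻¹ - 1 := by rw [sub_pos]; exact (one_lt_inv_iff₀.2 ⟨hq0, hq1⟩)
    have h4 : (0 : ℝ) < 2⁻¹ * (1 - 2⁻¹) := by norm_num
    exact mul_pos h4 hr
  rw [Set.inter_comm] at hdef
  by_contra hcon
  have hb : (∑ ω : BondConfig V, rcWeightW (Function.update w s(x, y) 0) q ∅ ω *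
        ind (openConn x y ∩ {ω | ω \ {s(x, y)} ∈ F}) ω) * rcPartitionFunctionW (Function.update w s(x, y) 0) q ∅ -
      (∑ ω : BondConfig V, rcWeightW (Function.update w s(x, y) 0) q ∅ ω * ind (openConn x y) ω) *
        (∑ ω : BondConfig V, rcWeightW (Function.update w s(x, y) 0) q ∅ ω * ind {ω | ω \ {s(x, y)} ∈ F} ω) < 0 :=
    not_le.1 hcon
  nlinarith [mul_pos hpos (neg_pos.2 hb)]

/-- **Conditioning on a connection raises the measure ⇒ an open edge lowers the rest** (`0 < q < 1`): duality read forwards.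
[cite: Grimmett2006, §3.9 (pp. 63–64)] -/
theorem edgeNegDepOn_of_connUpCorrOn {q : ℝ} (hq0 : 0 < q) (hq1 : q < 1) (hUPC : ConnUpCorrOn V q) : EdgeNegDepOn V q := by
  intro w e F hdiag hF hFe
  induction e using Sym2.ind with
  | h x y =>
  have hZ := rcPartitionFunctionW_pos w hq0 (∅ : Set V)
  rw [rcMeasureW_real_eq_sum_div w hq0 ∅, rcMeasureW_real_eq_sum_div w hq0 ∅, rcMeasureW_real_eq_sum_div w hq0 ∅,
    div_mul_div_comm, div_le_div_iff₀ hZ (mul_pos hZ hZ)]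
  suffices hdef : (∑ ω : BondConfig V, rcWeightW w q ∅ ω * ind ({ω | s(x, y) ∈ ω} ∩ F) ω) * rcPartitionFunctionW w q ∅ -
      (∑ ω : BondConfig V, rcWeightW w q ∅ ω * ind {ω | s(x, y) ∈ ω} ω) *
        (∑ ω : BondConfig V, rcWeightW w q ∅ ω * ind F ω) ≤ 0 by
    have h2 := mul_le_mul_of_nonneg_right hdef hZ.le
    linarith [h2]
  rw [openPair_defect_eq_neg_conn_defect w hq0.ne' x y F hFe]
  -- UPC one edge down
  have hU := hUPC (Function.update w s(x, y) 0) x y F hF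
  have hZ0 := rcPartitionFunctionW_pos (Function.update w s(x, y) 0) hq0 (∅ : Set V)
  rw [rcMeasureW_real_eq_sum_div _ hq0 ∅, rcMeasureW_real_eq_sum_div _ hq0 ∅, rcMeasureW_real_eq_sum_div _ hq0 ∅,
    div_mul_div_comm, div_le_div_iff₀ (mul_pos hZ0 hZ0) hZ0] at hU
  have hD : 0 ≤ (∑ ω : BondConfig V, rcWeightW (Function.update w s(x, y) 0) q ∅ ω * ind (F ∩ openConn x y) ω) *
        rcPartitionFunctionW (Function.update w s(x, y) 0) q ∅ -
      (∑ ω : BondConfig V, rcWeightW (Function.update w s(x, y) 0) q ∅ ω * ind (openConn x y) ω) *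
        (∑ ω : BondConfig V, rcWeightW (Function.update w s(x, y) 0) q ∅ ω * ind F ω) := by
    rw [Set.inter_comm]; nlinarith [hU, hZ0]
  have hc0 : 0 ≤ ((w s(x, y) : unitInterval) : ℝ) := (w s(x, y)).2.1
  have hc1 : ((w s(x, y) : unitInterval) : ℝ) ≤ 1 := (w s(x, y)).2.2
  have hr : 0 ≤ q⁻¹ - 1 := by rw [sub_nonneg]; exact (one_lt_inv_iff₀.2 ⟨hq0, hq1⟩).le
  have hfac : 0 ≤ ((w s(x, y) : unitInterval) : ℝ) * (1 - ((w s(x, y) : unitInterval) : ℝ)) * (q⁻¹ - 1) := by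
    have h1 : 0 ≤ 1 - ((w s(x, y) : unitInterval) : ℝ) := by linarith
    positivity
  nlinarith [mul_nonneg hfac hD]

/-- **For `0 < q < 1`: conditioning on a connection raises the measure IFF an open edge lowers the rest.**
[cite: Grimmett2006, §3.9 (pp. 63–64); Thm. (3.8)] -/
theorem connUpCorrOn_iff_edgeNegDepOn {q : ℝ} (hq0 : 0 < q) (hq1 : q < 1) : ConnUpCorrOn V q ↔ EdgeNegDepOn V q :=
  ⟨edgeNegDepOn_of_connUpCorrOn hq0 hq1, connUpCorrOn_of_edgeNegDepOn hq0 hq1⟩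

/-! ### Corollaries and the `q ≥ 1` discharge -/

/-- CD ⇒ edge-negative association (`F = J_f`). [cite: Grimmett2006, §3.9 eq. (3.94) (p. 63)] -/
theorem edgeNegCorrOn_of_edgeNegDepOn {q : ℝ} (hCD : EdgeNegDepOn V q) : EdgeNegCorrOn V q :=
  fun w e f hdiag hfe => hCD w e {ω | f ∈ ω} hdiag (fun _ _ hle hf => hle hf) (symmDiff_singleton_mem_openPair_iff hfe)

/-- UPC ⇒ pairwise positive correlation of two-point connection events (`F = {u ↔ v}`).
[cite: AyyerLinussonRavichandran2025, §7 eq. (13)–(15) (p. 22)] -/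
theorem pairConnPosUnder_of_connUpCorrOn {q : ℝ} (hq : 0 < q) (hUPC : ConnUpCorrOn V q) (w : Sym2 V → unitInterval)
    (x y u v : V) : PairConnPosUnder (rcMeasureW w q ∅) x y u v := by
  haveI := isProbabilityMeasure_rcMeasureW w hq (∅ : Set V)
  unfold PairConnPosUnder
  rw [probReal_univ, one_mul]
  exact hUPC w x y (openConn u v) fun _ _ hle hω => SimpleGraph.Reachable.mono (SimpleGraph.fromEdgeSet_mono hle) hω

/-- UPC ⇒ EC⁺ (`F = J_f`, then the one-edge covariance identity; any `q > 0`). [cite: Grimmett2006, Thm. (3.21) (p. 43); §3.9] -/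
theorem edgeConnMonoOn_of_connUpCorrOn {q : ℝ} (hq : 0 < q) (hUPC : ConnUpCorrOn V q) : EdgeConnMonoOn V q := by
  intro w f x y
  rw [real_le_real_iff_mass hq]
  set half : unitInterval := ⟨2⁻¹, by norm_num, by norm_num⟩ with hhalf
  have hU := hUPC (Function.update w f half) x y {ω | f ∈ ω} (fun _ _ hle hf => hle hf)
  have hZ := rcPartitionFunctionW_pos (Function.update w f half) hq (∅ : Set V)
  rw [rcMeasureW_real_eq_sum_div _ hq ∅, rcMeasureW_real_eq_sum_div _ hq ∅, rcMeasureW_real_eq_sum_div _ hq ∅,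
    div_mul_div_comm, div_le_div_iff₀ (mul_pos hZ hZ) hZ] at hU
  have hD : 0 ≤ (∑ ω : BondConfig V, rcWeightW (Function.update w f half) q ∅ ω * ind (openConn x y ∩ {ω | f ∈ ω}) ω) *
        rcPartitionFunctionW (Function.update w f half) q ∅ -
      (∑ ω : BondConfig V, rcWeightW (Function.update w f half) q ∅ ω * ind (openConn x y) ω) *
        (∑ ω : BondConfig V, rcWeightW (Function.update w f half) q ∅ ω * ind {ω | f ∈ ω} ω) := by nlinarith [hU, hZ]
  rw [inter_openPair_defect_eq, Function.update_self, Function.update_idem, Function.update_idem] at hD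
  have h2 : ((half : unitInterval) : ℝ) = 2⁻¹ := rfl
  rw [h2] at hD
  nlinarith [hD]

/-- **UPC holds for `q ≥ 1`** (FKG, Grimmett 2006 Thm. (3.8)). [cite: Grimmett2006, Thm. (3.8)] -/
theorem connUpCorrOn_of_one_le {q : ℝ} (hq : 1 ≤ q) : ConnUpCorrOn V q := fun w _ _ _ hF =>
  rcMeasureW_fkg w hq ∅ (fun _ _ hle hω => SimpleGraph.Reachable.mono (SimpleGraph.fromEdgeSet_mono hle) hω) hF

/-- The conjecture nodes: single-edge negative dependence for `q < 1` ⇒ UPC for every `q > 0`. [cite: Grimmett2006, §3.9; Thm. (3.8)] -/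
theorem connUpCorrFKPos_of_edgeNegDepFKLtOne (h : EdgeNegDepFKLtOne) : ConnUpCorrFKPos := by
  intro q hq n
  by_cases hq1 : q < 1
  · exact connUpCorrOn_of_edgeNegDepOn hq hq1 (h q hq hq1 n)
  · exact connUpCorrOn_of_one_le (not_lt.1 hq1)

/-- UPC for every `q > 0` ⇒ pairwise positive correlation of connection events for every `q > 0`.
[cite: AyyerLinussonRavichandran2025, §7 Conj. 7.1 (p. 22)] -/
theorem pairConnPosFKPos_of_connUpCorrFKPos (h : ConnUpCorrFKPos) : PairConnPosFKPos :=
  fun q hq n w x y u v => pairConnPosUnder_of_connUpCorrOn hq (h q hq n) w x y u v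

/-- Single-edge negative dependence ⇒ edge-negative association (conjecture nodes). [cite: Grimmett2006, §3.9 eq. (3.94) (p. 63)] -/
theorem edgeNegCorrFKLtOne_of_edgeNegDepFKLtOne (h : EdgeNegDepFKLtOne) : EdgeNegCorrFKLtOne :=
  fun q hq hq1 n => edgeNegCorrOn_of_edgeNegDepOn (h q hq hq1 n)

end FK

end Summit.CriticalPhenomena.PercolationContinuityZ3.Theorems

end
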